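import Mathlib.Analysis.SpecialFunctions.SmoothTransition
import Mathlib.Analysis.Calculus.ContDiff.Deriv
import Mathlib.Analysis.Calculus.ContDiff.Operations
import HarnessLib

/-!
# Derivatives of `expNegInvGlue` and of `Real.smoothTransition`; convexity of the transition at `0⁺`

Topic `Literature/Analysis/Calculus`. Mathlib's standard smooth transition
`Real.smoothTransition x = g(x)/(g(x) + g(1-x))`, `g = expNegInvGlue` (`g(x) = e^{-1/x}` for
`x > 0`, `0` for `x ≤ 0`), is the building block of the tree's plateau cut-offs
(`Literature.Analysis.Calculus.cutoff`). For the cut-off functions of Scheffer's construction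
one needs a one-dimensional profile whose THIRD derivative is positive just to the right of the
left end of its support (W. S. Ożański, arXiv:1709.00602, Appendix 8.1, proof of Lemma 21:
"`fᵢ''' > 0` on `(aᵢ, aᵢ+ε)` … take for instance `exp(-(x-aᵢ)⁻²)` …", feeding his Corollary 20,
`Literature.Analysis.Calculus.boundary_ineq_left`). This file proves that `Real.smoothTransition`
itself has this property, so that profiles can be built from it without any gluing:

* `deriv_expNegInvGlue`, `deriv2_expNegInvGlue`, `deriv3_expNegInvGlue`: the first three
  derivatives of `g` in closed form, `g' = x⁻²g`, `g'' = (x⁻⁴ - 2x⁻³)g`,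
  `g''' = (x⁻⁶ - 6x⁻⁵ + 6x⁻⁴)g` (globally, from Mathlib's
  `expNegInvGlue.hasDerivAt_polynomial_eval_inv_mul`);
* `glueDenomInv = (g(x) + g(1-x))⁻¹` (smooth, positive) and
  `smoothTransition_eq_mul : smoothTransition = g · glueDenomInv`;
* `deriv3_mul`: the Leibniz formula for the third derivative of a product of smooth functions;
* `exists_deriv3_smoothTransition_pos`: **there is `t₀ > 0` with `smoothTransition''' > 0` on
  `(0, t₀)`** (after factoring `g(t) t⁻⁶`, the third derivative is a continuous function of `t`
  with value `glueDenomInv 0 = e > 0` at `t = 0`).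

## References

* W. S. Ożański, arXiv:1709.00602 (2017), Appendix 8.1 (proof of Lemma 21). [`Ozanski2017NSIInternal`]
-/

noncomputable section

open Set Filter Polynomial
open scoped Topology ContDiff

namespace Literature.Analysis.Calculus

/-! ### Derivatives of `expNegInvGlue` -/

/-- Derivative of `x ↦ p(x⁻¹) g(x)` in closed form (Mathlib's
`expNegInvGlue.hasDerivAt_polynomial_eval_inv_mul`, as an identity of functions). [folklore] -/
theorem deriv_polynomial_eval_inv_mul_expNegInvGlue (p : ℝ[X]) :
    deriv (fun x => p.eval x⁻¹ * expNegInvGlue x) =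
      fun x => (X ^ 2 * (p - derivative p)).eval x⁻¹ * expNegInvGlue x :=
  funext fun x => (expNegInvGlue.hasDerivAt_polynomial_eval_inv_mul p x).deriv

/-- `g' = x⁻² g` for `g = expNegInvGlue` (valid on all of `ℝ`; both sides vanish for `x ≤ 0`).
[folklore] -/
theorem deriv_expNegInvGlue : deriv expNegInvGlue = fun x => x⁻¹ ^ 2 * expNegInvGlue x := by
  have e : expNegInvGlue = fun x => (1 : ℝ[X]).eval x⁻¹ * expNegInvGlue x := by
    funext x; simp
  conv_lhs => rw [e]
  rw [deriv_polynomial_eval_inv_mul_expNegInvGlue]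
  funext x
  simp

/-- `g'' = (x⁻⁴ - 2x⁻³) g` for `g = expNegInvGlue`. [folklore] -/
theorem deriv2_expNegInvGlue :
    deriv (deriv expNegInvGlue) = fun x => (x⁻¹ ^ 4 - 2 * x⁻¹ ^ 3) * expNegInvGlue x := by
  rw [deriv_expNegInvGlue]
  have e : (fun x : ℝ => x⁻¹ ^ 2 * expNegInvGlue x) =
      fun x => (X ^ 2 : ℝ[X]).eval x⁻¹ * expNegInvGlue x := by
    funext x; simp
  rw [e, deriv_polynomial_eval_inv_mul_expNegInvGlue]
  funext x
  simp only [derivative_X_pow, map_ofNat, Nat.cast_ofNat, Nat.add_one_sub_one, pow_one,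
    eval_mul, eval_pow, eval_X, eval_sub, eval_ofNat]
  ring

/-- `g''' = (x⁻⁶ - 6x⁻⁵ + 6x⁻⁴) g` for `g = expNegInvGlue`. [folklore] -/
theorem deriv3_expNegInvGlue :
    deriv (deriv (deriv expNegInvGlue)) =
      fun x => (x⁻¹ ^ 6 - 6 * x⁻¹ ^ 5 + 6 * x⁻¹ ^ 4) * expNegInvGlue x := by
  rw [deriv2_expNegInvGlue]
  have e : (fun x : ℝ => (x⁻¹ ^ 4 - 2 * x⁻¹ ^ 3) * expNegInvGlue x) =
      fun x => (X ^ 4 - 2 * X ^ 3 : ℝ[X]).eval x⁻¹ * expNegInvGlue x := by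
    funext x; simp
  rw [e, deriv_polynomial_eval_inv_mul_expNegInvGlue]
  funext x
  simp only [derivative_sub, derivative_X_pow, map_ofNat, Nat.cast_ofNat, derivative_mul,
    derivative_ofNat, zero_mul, zero_add, eval_mul, eval_pow, eval_X, eval_sub, eval_ofNat,
    Nat.add_one_sub_one]
  ring

/-! ### The smooth transition as a product -/

/-- The reciprocal `(g(x) + g(1-x))⁻¹` of the denominator of `Real.smoothTransition`
(`g = expNegInvGlue`); smooth and positive on `ℝ`. [folklore] -/
def glueDenomInv (x : ℝ) : ℝ :=
  (expNegInvGlue x + expNegInvGlue (1 - x))⁻¹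

/-- The denominator reciprocal is positive. [folklore] -/
theorem glueDenomInv_pos (x : ℝ) : 0 < glueDenomInv x :=
  inv_pos.2 (Real.smoothTransition.pos_denom x)

/-- At `0` the denominator reciprocal is `1/g(1) = e`. [folklore] -/
theorem glueDenomInv_zero : glueDenomInv 0 = (expNegInvGlue 1)⁻¹ := by
  simp [glueDenomInv, expNegInvGlue.zero]

/-- The denominator reciprocal is smooth. [folklore] -/
theorem contDiff_glueDenomInv : ContDiff ℝ ∞ glueDenomInv := by
  have h : ContDiff ℝ ∞ fun x => expNegInvGlue x + expNegInvGlue (1 - x) :=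
    expNegInvGlue.contDiff.add (expNegInvGlue.contDiff.comp (contDiff_const.sub contDiff_id))
  exact h.inv fun x => (Real.smoothTransition.pos_denom x).ne'

/-- `smoothTransition = g · glueDenomInv`. [folklore] -/
theorem smoothTransition_eq_mul :
    Real.smoothTransition = fun x => expNegInvGlue x * glueDenomInv x := by
  funext x
  simp [Real.smoothTransition, glueDenomInv, div_eq_mul_inv]

/-! ### The Leibniz formula for a third derivative -/

/-- Derivative of a product of smooth functions, as an identity of functions. [folklore] -/
theorem deriv_mul_of_contDiff {φ ψ : ℝ → ℝ} (hφ : ContDiff ℝ ∞ φ) (hψ : ContDiff ℝ ∞ ψ) :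
    deriv (fun x => φ x * ψ x) = fun x => deriv φ x * ψ x + φ x * deriv ψ x :=
  funext fun x => deriv_mul (hφ.differentiable (by simp) x) (hψ.differentiable (by simp) x)

/-- Derivative of a sum of smooth functions, as an identity of functions. [folklore] -/
theorem deriv_add_of_contDiff {φ ψ : ℝ → ℝ} (hφ : ContDiff ℝ ∞ φ) (hψ : ContDiff ℝ ∞ ψ) :
    deriv (fun x => φ x + ψ x) = fun x => deriv φ x + deriv ψ x :=
  funext fun x => deriv_add (hφ.differentiable (by simp) x) (hψ.differentiable (by simp) x)

/-- **Leibniz formula for the third derivative** of a product of smooth functions: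
`(φψ)''' = φ'''ψ + 3φ''ψ' + 3φ'ψ'' + φψ'''`. [folklore] -/
theorem deriv3_mul {φ ψ : ℝ → ℝ} (hφ : ContDiff ℝ ∞ φ) (hψ : ContDiff ℝ ∞ ψ) :
    deriv (deriv (deriv fun x => φ x * ψ x)) = fun x =>
      deriv (deriv (deriv φ)) x * ψ x + 3 * (deriv (deriv φ) x * deriv ψ x) +
        3 * (deriv φ x * deriv (deriv ψ) x) + φ x * deriv (deriv (deriv ψ)) x := by
  -- smoothness of all the derivatives involved
  have hφ1 : ContDiff ℝ ∞ (deriv φ) := hφ.iterate_deriv 1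
  have hφ2 : ContDiff ℝ ∞ (deriv (deriv φ)) := hφ.iterate_deriv 2
  have hψ1 : ContDiff ℝ ∞ (deriv ψ) := hψ.iterate_deriv 1
  have hψ2 : ContDiff ℝ ∞ (deriv (deriv ψ)) := hψ.iterate_deriv 2
  -- first derivative
  rw [deriv_mul_of_contDiff hφ hψ]
  -- second derivative
  rw [deriv_add_of_contDiff (hφ1.mul hψ) (hφ.mul hψ1), deriv_mul_of_contDiff hφ1 hψ,
    deriv_mul_of_contDiff hφ hψ1]
  -- third derivative
  have e3 : (fun x => deriv (deriv φ) x * ψ x + deriv φ x * deriv ψ x +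
      (deriv φ x * deriv ψ x + φ x * deriv (deriv ψ) x)) =
      fun x => (deriv (deriv φ) x * ψ x + deriv φ x * deriv ψ x) +
        (deriv φ x * deriv ψ x + φ x * deriv (deriv ψ) x) := rfl
  rw [e3, deriv_add_of_contDiff ((hφ2.mul hψ).add (hφ1.mul hψ1)) ((hφ1.mul hψ1).add (hφ.mul hψ2)),
    deriv_add_of_contDiff (hφ2.mul hψ) (hφ1.mul hψ1), deriv_add_of_contDiff (hφ1.mul hψ1) (hφ.mul hψ2),
    deriv_mul_of_contDiff hφ2 hψ, deriv_mul_of_contDiff hφ1 hψ1, deriv_mul_of_contDiff hφ hψ2]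
  funext x
  ring

/-! ### The third derivative of the transition near `0⁺` -/

/-- **The smooth transition has positive third derivative near `0⁺`**: there is `t₀ > 0` such
that `(Real.smoothTransition)''' > 0` on `(0, t₀)`. Indeed, with `S = g·E`,
`E = glueDenomInv`, Leibniz and the closed forms of `g', g'', g'''` give
`S'''(t) = g(t) t⁻⁶ Φ(t)` with
`Φ(t) = (1 - 6t + 6t²)E + 3(t² - 2t³)E' + 3t⁴E'' + t⁶E'''` continuous and `Φ(0) = E(0) = e > 0`
(the analogue, for Mathlib's transition, of Ożański's remark that `exp(-(x-a)⁻²)` has `f''' > 0`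
just right of `a`, App. 8.1). [cite: Ozanski2017NSIInternal, Appendix 8.1 (proof of Lemma 21)] -/
theorem exists_deriv3_smoothTransition_pos :
    ∃ t₀ > 0, ∀ t ∈ Ioo (0 : ℝ) t₀, 0 < deriv (deriv (deriv Real.smoothTransition)) t := by
  set E : ℝ → ℝ := glueDenomInv with hE_def
  have hE : ContDiff ℝ ∞ E := contDiff_glueDenomInv
  have hE1 : ContDiff ℝ ∞ (deriv E) := hE.iterate_deriv 1
  have hE2 : ContDiff ℝ ∞ (deriv (deriv E)) := hE.iterate_deriv 2
  have hE3 : ContDiff ℝ ∞ (deriv (deriv (deriv E))) := hE.iterate_deriv 3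
  -- the continuous factor `Φ`
  set Φ : ℝ → ℝ := fun t => (1 - 6 * t + 6 * t ^ 2) * E t + 3 * (t ^ 2 - 2 * t ^ 3) * deriv E t +
    3 * t ^ 4 * deriv (deriv E) t + t ^ 6 * deriv (deriv (deriv E)) t with hΦ_def
  have hΦc : Continuous Φ := by
    have c0 := hE.continuous
    have c1 := hE1.continuous
    have c2 := hE2.continuous
    have c3 := hE3.continuous
    simp only [hΦ_def]
    fun_prop
  have hΦ0 : 0 < Φ 0 := by
    simp only [hΦ_def]
    norm_num
    exact glueDenomInv_pos 0
  -- `Φ > 0` near `0`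
  obtain ⟨t₀, ht₀, hpos⟩ : ∃ t₀ > 0, ∀ t, |t| < t₀ → 0 < Φ t := by
    have hev : ∀ᶠ t in 𝓝 (0 : ℝ), 0 < Φ t := hΦc.continuousAt.eventually (lt_mem_nhds hΦ0)
    obtain ⟨t₀, ht₀, h⟩ := Metric.eventually_nhds_iff.1 hev
    exact ⟨t₀, ht₀, fun t ht => h (by simpa [Real.dist_eq] using ht)⟩
  refine ⟨t₀, ht₀, fun t ht => ?_⟩
  have ht0 : t ≠ 0 := ht.1.ne'
  -- the third derivative in closed form
  have hderiv : deriv (deriv (deriv Real.smoothTransition)) t =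
      expNegInvGlue t * t⁻¹ ^ 6 * Φ t := by
    rw [smoothTransition_eq_mul, deriv3_mul expNegInvGlue.contDiff hE, deriv3_expNegInvGlue,
      deriv2_expNegInvGlue, deriv_expNegInvGlue]
    simp only [hΦ_def]
    field_simp
  rw [hderiv]
  have h1 : 0 < expNegInvGlue t := expNegInvGlue.pos_of_pos ht.1
  have h2 : 0 < t⁻¹ ^ 6 := by positivity
  have h3 : 0 < Φ t := hpos t (by rw [abs_of_pos ht.1]; exact ht.2)
  positivity

end Literature.Analysis.Calculus
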